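import Mathlib.Tactic.LinearCombination
import Summits.QuantumAdvantage.QuantumAdvantage.Theorems.CubicForrelationNearExactIsExactRmWeight
import Summits.QuantumAdvantage.QuantumAdvantage.Theorems.CubicForrelationNearExactIsExactBentDuality
import Summits.QuantumAdvantage.QuantumAdvantage.Theorems.CubicForrelationNearExactIsExactQuadPerturb
import Summits.QuantumAdvantage.QuantumAdvantage.Theorems.CubicForrelationNearExactIsExactConcatAveraging
import Summits.QuantumAdvantage.QuantumAdvantage.Theorems.CubicForrelationNearExactIsExactMmFormCeilingA
import Literature.Computability.QuantumComplexity.ForrelationDirectSum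

/-!
# Crux `CubicForrelation.NearExactIsExact` (stmt-QuantumAdvantage-14043) — the rank-2 perturbation ceiling (file A)

Line `direct-sum-amplification`, helper stub `ar_rankTwoCeiling` (tag AR2). THEOREM (`ar_rankTwoCeiling_of_derivDegree`,
here from the statement of stub D "derivatives lower the degree" as a hypothesis `hD`; the companion file
`CubicForrelationNearExactIsExactRankTwoCeiling.lean` discharges `hD` with the landed `stub_derivDegree`): for an EXACT
cubic pair `(d, g)` on `n = m + m` bits in dual form `W_g(x) = 2^m (-1)^{d(x)}`, affine `ℓ₁ ℓ₂ ℓ₃` and ANY cubic `f`,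
`Φ(f, g ⊕ ℓ₁ℓ₂ ⊕ ℓ₃) = 1 ∨ Φ(f, g ⊕ ℓ₁ℓ₂ ⊕ ℓ₃) ≤ 31/32` — a ceiling for rank-2 quadratic perturbations of exact pairs,
which need not be Maiorana–McFarland shaped. Proof:
* `ar_affine_signForm` (| hD): an affine function reads `(-1)^{ℓ(x)} = (-1)^c (-1)^{x·u}` — its first differences are
  constant (`ar_affine_apply_bxor`), so `S(x) = (-1)^{ℓ(0) ⊕ ℓ(x)}` is a character of `(𝔽₂ⁿ, ⊕)`, and a character equals
  `(-1)^{x·u}` for any `u` with `W_S(u) ≠ 0` (Parseval `sum_W_sq` + the shift identity `sum_shift_twist`);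
* `ar_signOf_and`: `(-1)^{a∧b} = (1 + (-1)^a + (-1)^b − (-1)^a(-1)^b)/2`, so `(-1)^{ℓ₁ℓ₂ ⊕ ℓ₃}` is half a signed sum of
  FOUR characters, and translate duality gives `W_{g ⊕ p}(x) = 2^m · S(x)/2`, `S(x) = Σ_{i<4} (-1)^{eᵢ(x)}`,
  `eᵢ(x) = bᵢ ⊕ d(x ⊕ vᵢ)` (`ar_W_perturb`; no Walsh transform of the perturbation is needed); hence
  `Φ = 2^{-n} Σ_x (-1)^{f(x)} S(x)/2` (`ar_forrelation_of_W`) and, by PARSEVAL, `Σ_x S(x)² = 4·2ⁿ`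
  (`ar_second_moment_of_W`) — uniformly, with no case distinction on coinciding characters;
* degrees (| hD): `eᵢ` is cubic, `e₀ ⊕ eᵢ` quadratic (a derivative of a translate; `ar_deg_e`, `ar_deg_pair`);
* COUNTING (`ar_count`, Reed–Muller bound = landed `stub_rmWeight hD`): pointwise `2(-1)^f S + 8[e₀=e₁=e₂=e₃] ≤ S²`
  (`ar_pt_ineq`), so `Σ(-1)^f S ≤ 2·2ⁿ − 4|Z|` for the coincidence set `Z` of degree `≤ 6`; `Z ≠ ∅ ⇒ |Z| ≥ 2ⁿ/64 ⇒
  Φ ≤ 31/32`; `Z = ∅ ⇒ S² = 4` everywhere (`ar_pt_sq_le`), `S = 2(-1)^{maj(e₀,e₁,e₂)}` (`ar_pt_maj`), and `Φ` is the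
  bias of the word `f ⊕ maj` of degree `≤ 6`: zero `⇒ Φ = 1`, else weight `≥ 2ⁿ/64 ⇒ Φ ≤ 31/32`.

Sources: S. Aaronson, A. Ambainis, Forrelation, SIAM J. Comput. 47 (2018) §1.1.1 (`Φ`); O. Rothaus, On "bent"
functions, JCTA 20 (1976) (duality); F. J. MacWilliams, N. J. A. Sloane, The Theory of Error-Correcting Codes (1977)
Ch. 13 (Reed–Muller weights) — orientation only: everything is proved from the tree's forrelation files and the landed
helper modules of this line (never the Theses file); axioms standard.
-/

set_option linter.dupNamespace false -- D-0017: single-problem summit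

namespace Summit.QuantumAdvantage.QuantumAdvantage.Theorems.CubicForrelation.NearExactIsExact

open Finset
open Literature.Computability.QuantumComplexity
open Literature.Computability.QuantumComplexity.BuzetChailloux (bxor zeroVec signOf_sq bxor_comm zeroVec_bxor
  twist_bxor_right)
open Literature.Computability.QuantumComplexity.DerivativeWalsh (W sum_shift_twist sum_W_sq signOf_not)

variable {n : ℕ}

/-! ### Affine Boolean functions are characters up to a sign -/

/-- A Boolean function of algebraic degree `≤ 0` is constant (`totalDegree p = 0 ⇒ p = C _`). -/
theorem ar_const_of_deg_zero {F : (Fin n → Bool) → Bool} (h : IsDegLeFun 0 F) (x y : Fin n → Bool) :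
    F x = F y := by
  obtain ⟨p, hp, hF⟩ := h
  have hpC : p = MvPolynomial.C (p.coeff 0) :=
    MvPolynomial.totalDegree_eq_zero_iff_eq_C.mp (Nat.le_zero.mp hp)
  rw [hF, hF, hpC, polyPhase_C, polyPhase_C]

/-- Bool bookkeeping: `a ⊕ b = c ⊕ e ⇒ b = a ⊕ (c ⊕ e)`. -/
theorem ar_bool_shift : ∀ a b c e : Bool, (a ^^ b) = (c ^^ e) → b = (a ^^ (c ^^ e)) := by decide

/-- An affine function (degree `≤ 1`) is additive up to its value at `0`: `ℓ(x ⊕ t) = ℓ(x) ⊕ ℓ(0) ⊕ ℓ(t)`, GIVEN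
that derivatives lower the degree (`hD`, stub D): the derivative of `ℓ` in direction `t` has degree `≤ 0`, so it
is constant (`ar_const_of_deg_zero`). -/
theorem ar_affine_apply_bxor
    (hD : ∀ (n d : ℕ) (e : (Fin n → Bool) → Bool) (t : Fin n → Bool), IsDegLeFun (d + 1) e →
      IsDegLeFun d (fun x => e x ^^ e (bxor x t)))
    {ℓ : (Fin n → Bool) → Bool} (h : IsDegLeFun 1 ℓ) (x t : Fin n → Bool) :
    ℓ (bxor x t) = (ℓ x ^^ (ℓ zeroVec ^^ ℓ t)) := by
  have key : (ℓ x ^^ ℓ (bxor x t)) = (ℓ zeroVec ^^ ℓ (bxor zeroVec t)) :=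
    ar_const_of_deg_zero (hD n 0 ℓ t h) x zeroVec
  rw [zeroVec_bxor] at key
  exact ar_bool_shift _ _ _ _ key

/-- **Affine functions in sign form** (GIVEN stub D as `hD`). A Boolean function of algebraic degree `≤ 1` reads
`(-1)^{ℓ(x)} = (-1)^{c} (-1)^{x·u}` for a bit `c` (`= ℓ(0)`) and a vector `u`. Proof: `S(x) := (-1)^{ℓ(0) ⊕ ℓ(x)}`
is multiplicative under `⊕` (`ar_affine_apply_bxor`); by Parseval (`sum_W_sq`) some Walsh coefficient `W_S(u)` is
nonzero, and the shift identity `Σ_h S(y ⊕ h)(-1)^{h·u} = (-1)^{y·u} W_S(u)` (`sum_shift_twist`) reads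
`S(y) W_S(u) = (-1)^{y·u} W_S(u)`, so `S(y) = (-1)^{y·u}`. -/
theorem ar_affine_signForm
    (hD : ∀ (n d : ℕ) (e : (Fin n → Bool) → Bool) (t : Fin n → Bool), IsDegLeFun (d + 1) e →
      IsDegLeFun d (fun x => e x ^^ e (bxor x t)))
    {ℓ : (Fin n → Bool) → Bool} (h : IsDegLeFun 1 ℓ) :
    ∃ (c : Bool) (u : Fin n → Bool), ∀ x, signOf (ℓ x) = signOf c * twist x u := by
  set S : (Fin n → Bool) → ℝ := fun x => signOf (ℓ zeroVec) * signOf (ℓ x) with hS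
  have hmul : ∀ x t, S (bxor x t) = S x * S t := fun x t => by
    simp only [hS, ar_affine_apply_bxor hD h x t, signOf_xor]
    ring
  have hsq : ∀ x, S x ^ 2 = 1 := fun x => by
    simp only [hS, mul_pow, signOf_sq, mul_one]
  have hone : ∑ y : Fin n → Bool, S y ^ 2 = (2 : ℝ) ^ n := by
    rw [sum_congr rfl fun y _ => hsq y, sum_const, card_univ, Fintype.card_fun, Fintype.card_bool,
      Fintype.card_fin]
    norm_num
  have hpar : ∑ u, W S u ^ 2 = (2 : ℝ) ^ n * (2 : ℝ) ^ n := by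
    rw [sum_W_sq, hone]
  obtain ⟨u, -, hu⟩ : ∃ u ∈ (univ : Finset (Fin n → Bool)), W S u ^ 2 ≠ 0 :=
    exists_ne_zero_of_sum_ne_zero (by rw [hpar]; positivity)
  have hu' : W S u ≠ 0 := fun h0 => hu (by rw [h0, sq, mul_zero])
  refine ⟨ℓ zeroVec, u, fun y => ?_⟩
  have hshift := sum_shift_twist S y u
  have hlhs : ∑ h, S (bxor y h) * twist h u = S y * W S u := by
    simp only [hmul]
    rw [W, mul_sum]
    exact sum_congr rfl fun h _ => by ring
  have hSy : S y = twist y u := mul_right_cancel₀ hu' (hlhs.symm.trans hshift)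
  have hSy' : signOf (ℓ zeroVec) * signOf (ℓ y) = twist y u := hSy
  calc signOf (ℓ y) = signOf (ℓ zeroVec) ^ 2 * signOf (ℓ y) := by rw [signOf_sq, one_mul]
    _ = signOf (ℓ zeroVec) * (signOf (ℓ zeroVec) * signOf (ℓ y)) := by ring
    _ = signOf (ℓ zeroVec) * twist y u := by rw [hSy']

/-! ### Degrees of translates -/

/-- Translation keeps the algebraic degree: `x ↦ F(x ⊕ v)` has degree `≤ k` if `F` has (substitute `X_j ↦ X_j + v_j`,
all of degree `≤ 1`; `fc_isDegLeFun_comp`). -/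
theorem ar_isDegLeFun_shift {k : ℕ} {F : (Fin n → Bool) → Bool} (hF : IsDegLeFun k F) (v : Fin n → Bool) :
    IsDegLeFun k (fun x => F (bxor x v)) :=
  fc_isDegLeFun_comp hF (fun x => bxor x v)
    (fun j => bb_isDegLeFun_bxor (isDegLeFun_apply j le_rfl) (isDegLeFun_const 1 (v j))) (one_mul k).le

/-- A signed translate `x ↦ b ⊕ d(x ⊕ v)` of a cubic `d` is cubic. -/
theorem ar_deg_e {d : (Fin n → Bool) → Bool} (hd : IsDegLeFun 3 d) (b : Bool) (v : Fin n → Bool) :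
    IsDegLeFun 3 (fun x => b ^^ d (bxor x v)) :=
  bb_isDegLeFun_bxor (isDegLeFun_const 3 b) (ar_isDegLeFun_shift hd v)

/-- Bool bookkeeping: `(b ⊕ b') ⊕ (p ⊕ q) = (b ⊕ p) ⊕ (b' ⊕ q)`. -/
theorem ar_bool_pair : ∀ b b' p q : Bool, ((b ^^ b') ^^ (p ^^ q)) = ((b ^^ p) ^^ (b' ^^ q)) := by decide

/-- The xor of two signed translates of a cubic `d` is quadratic (GIVEN stub D as `hD`): up to the constant `b ⊕ b'`
it is the derivative of the cubic `x ↦ d(x ⊕ v)` in direction `v ⊕ v'`. -/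
theorem ar_deg_pair
    (hD : ∀ (n d : ℕ) (e : (Fin n → Bool) → Bool) (t : Fin n → Bool), IsDegLeFun (d + 1) e →
      IsDegLeFun d (fun x => e x ^^ e (bxor x t)))
    {d : (Fin n → Bool) → Bool} (hd : IsDegLeFun 3 d) (b b' : Bool) (v v' : Fin n → Bool) :
    IsDegLeFun 2 (fun x => (b ^^ d (bxor x v)) ^^ (b' ^^ d (bxor x v'))) := by
  have h1 : IsDegLeFun 2 (fun x => d (bxor x v) ^^ d (bxor (bxor x (bxor v v')) v)) :=
    hD n 2 (fun x => d (bxor x v)) (bxor v v') (ar_isDegLeFun_shift hd v)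
  have h2 : IsDegLeFun 2 (fun x => (b ^^ b') ^^ (d (bxor x v) ^^ d (bxor (bxor x (bxor v v')) v))) :=
    bb_isDegLeFun_bxor (isDegLeFun_const 2 (b ^^ b')) h1
  refine rm_isDegLeFun_congr h2 fun x => ?_
  have e : bxor (bxor x (bxor v v')) v = bxor x v' := by
    funext i
    show ((x i ^^ (v i ^^ v' i)) ^^ v i) = (x i ^^ v' i)
    cases x i <;> cases v i <;> cases v' i <;> rfl
  show ((b ^^ b') ^^ (d (bxor x v) ^^ d (bxor (bxor x (bxor v v')) v))) =
    ((b ^^ d (bxor x v)) ^^ (b' ^^ d (bxor x v')))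
  rw [e]
  exact ar_bool_pair _ _ _ _

/-! ### The Walsh transform of a four-character perturbation of a bent function -/

/-- `(-1)^{a ∧ b} = (1 + (-1)^a + (-1)^b − (-1)^a (-1)^b)/2`. -/
theorem ar_signOf_and (a b : Bool) :
    signOf (a && b) = (1 + signOf a + signOf b - signOf a * signOf b) / 2 := by
  cases a <;> cases b <;> norm_num [signOf]

/-- Twisting by a character translates the Walsh transform:
`Σ_y G(y) (σ (-1)^{y·v}) (-1)^{y·x} = σ · W_G(x ⊕ v)`. -/
theorem ar_sum_twist_term (G : (Fin n → Bool) → ℝ) (σ : ℝ) (v x : Fin n → Bool) :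
    ∑ y, G y * (σ * twist y v) * twist y x = σ * W G (bxor x v) := by
  simp only [W, mul_sum]
  refine sum_congr rfl fun y _ => ?_
  rw [bxor_comm, twist_bxor_right]
  ring

/-- **Translate duality for a four-character perturbation.** If `W_g = 2^m (-1)^d` on `n = m + m` bits (the dual
form of an exact pair `(d, g)`) and `(-1)^{p(y)} = ½ Σ_{i<4} (-1)^{bᵢ} (-1)^{y·vᵢ}`, then
`W_{g ⊕ p}(x) = 2^m · ½ Σ_{i<4} (-1)^{bᵢ ⊕ d(x ⊕ vᵢ)}` (`W` is linear, a character twist translates `W_g`, and the dual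
form evaluates each translate). -/
theorem ar_W_perturb {m : ℕ} (g d p : (Fin (m + m) → Bool) → Bool) (b₀ b₁ b₂ b₃ : Bool)
    (v₀ v₁ v₂ v₃ : Fin (m + m) → Bool)
    (hdual : ∀ x, W (fun y => signOf (g y)) x = (2 : ℝ) ^ m * signOf (d x))
    (hp : ∀ y, signOf (p y) = (signOf b₀ * twist y v₀ + signOf b₁ * twist y v₁ + signOf b₂ * twist y v₂ +
      signOf b₃ * twist y v₃) / 2) (x : Fin (m + m) → Bool) :
    W (fun y => signOf (g y ^^ p y)) x = (2 : ℝ) ^ m * ((signOf (b₀ ^^ d (bxor x v₀)) +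
      signOf (b₁ ^^ d (bxor x v₁)) + signOf (b₂ ^^ d (bxor x v₂)) + signOf (b₃ ^^ d (bxor x v₃))) / 2) := by
  have key : ∀ y, 2 * (signOf (g y ^^ p y) * twist y x) =
      signOf (g y) * (signOf b₀ * twist y v₀) * twist y x + signOf (g y) * (signOf b₁ * twist y v₁) * twist y x +
        signOf (g y) * (signOf b₂ * twist y v₂) * twist y x +
        signOf (g y) * (signOf b₃ * twist y v₃) * twist y x := by
    intro y
    rw [signOf_xor, hp y]
    ring
  have h2 : 2 * W (fun y => signOf (g y ^^ p y)) x =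
      signOf b₀ * W (fun y => signOf (g y)) (bxor x v₀) + signOf b₁ * W (fun y => signOf (g y)) (bxor x v₁) +
        signOf b₂ * W (fun y => signOf (g y)) (bxor x v₂) + signOf b₃ * W (fun y => signOf (g y)) (bxor x v₃) := by
    rw [← ar_sum_twist_term (fun y => signOf (g y)) (signOf b₀) v₀ x,
      ← ar_sum_twist_term (fun y => signOf (g y)) (signOf b₁) v₁ x,
      ← ar_sum_twist_term (fun y => signOf (g y)) (signOf b₂) v₂ x,
      ← ar_sum_twist_term (fun y => signOf (g y)) (signOf b₃) v₃ x,
      ← sum_add_distrib, ← sum_add_distrib, ← sum_add_distrib, W, mul_sum]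
    exact sum_congr rfl fun y _ => key y
  rw [hdual, hdual, hdual, hdual] at h2
  rw [signOf_xor, signOf_xor, signOf_xor, signOf_xor]
  linear_combination (1 / 2 : ℝ) * h2

/-! ### Forrelation and second moment from the Walsh transform -/

/-- `Φ(f, G) = 2^{-n} Σ_x (-1)^{f(x)} E(x)` whenever `W_G(x) = 2^m E(x)` on `n = m + m` bits
(`Φ = 2^{-3n/2} Σ_x (-1)^{f(x)} W_G(x)` and `2^{-3m} · 2^m = 2^{-n}`). -/
theorem ar_forrelation_of_W {m : ℕ} (f G : (Fin (m + m) → Bool) → Bool) (E : (Fin (m + m) → Bool) → ℝ)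
    (hW : ∀ x, W (fun y => signOf (G y)) x = (2 : ℝ) ^ m * E x) :
    forrelation f G = ((2 : ℝ) ^ (m + m))⁻¹ * ∑ x, signOf (f x) * E x := by
  rw [qp_forrelation_eq_sum_mul_W, qp_sqrt_two_pow_three_mul_add_self]
  have h1 : ∑ x, signOf (f x) * W (fun y => signOf (G y)) x = (2 : ℝ) ^ m * ∑ x, signOf (f x) * E x := by
    rw [mul_sum]
    exact sum_congr rfl fun x _ => by rw [hW x]; ring
  have h2m : (2 : ℝ) ^ m ≠ 0 := by positivity
  rw [h1, show (2 : ℝ) ^ (3 * m) = 2 ^ m * 2 ^ (m + m) by ring, mul_inv, mul_assoc, mul_left_comm,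
    inv_mul_cancel_left₀ h2m]

/-- **Second moment by Parseval.** If `G` is `±1`-valued and `W_G(x) = A · E(x)/2` with `A² = 2ⁿ`, then
`Σ_x E(x)² = 4 · 2ⁿ` (`Σ_x W_G(x)² = 2ⁿ Σ_y G(y)² = 4ⁿ`). For `E = Σ_{i<4} (-1)^{eᵢ}` this is the identity
"`E_x β² = 1`" of the paper proof, obtained here without derivative balance or any distinctness of the characters. -/
theorem ar_second_moment_of_W {N : ℕ} (G E : (Fin N → Bool) → ℝ) (A : ℝ) (hA : A ≠ 0)
    (hG : ∀ y, G y ^ 2 = 1) (hW : ∀ x, W G x = A * (E x / 2)) (hN : (2 : ℝ) ^ N = A ^ 2) :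
    ∑ x, E x ^ 2 = 4 * (2 : ℝ) ^ N := by
  have hpar := sum_W_sq G
  have hone : ∑ y, G y ^ 2 = (2 : ℝ) ^ N := by
    rw [sum_congr rfl fun y _ => hG y, sum_const, card_univ, Fintype.card_fun, Fintype.card_bool,
      Fintype.card_fin]
    norm_num
  have hlhs : ∑ x, W G x ^ 2 = A ^ 2 / 4 * ∑ x, E x ^ 2 := by
    rw [mul_sum]
    exact sum_congr rfl fun x _ => by rw [hW x]; ring
  rw [hlhs, hone, hN] at hpar
  have hA2 : A ^ 2 ≠ 0 := pow_ne_zero 2 hA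
  have key : (∑ x, E x ^ 2) / 4 = A ^ 2 := mul_left_cancel₀ hA2 (by rw [← hpar]; ring)
  rw [hN]
  linarith


/-! ### Pointwise bookkeeping for the signed sum of four bits -/

/-- With `S = Σ_{i<4} (-1)^{eᵢ}` and `z = [e₀ = e₁ = e₂ = e₃]`: `2·(-1)^a·S + 8 z ≤ S²` (i.e. `|S| ≤ S²/2 − 4z`,
an equality unless `S = ±4`). -/
theorem ar_pt_ineq (a e₀ e₁ e₂ e₃ : Bool) :
    2 * (signOf a * (signOf e₀ + signOf e₁ + signOf e₂ + signOf e₃)) +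
        8 * (if (!(e₀ ^^ e₁) && (!(e₀ ^^ e₂) && !(e₀ ^^ e₃))) = true then (1 : ℝ) else 0) ≤
      (signOf e₀ + signOf e₁ + signOf e₂ + signOf e₃) ^ 2 := by
  cases a <;> cases e₀ <;> cases e₁ <;> cases e₂ <;> cases e₃ <;> norm_num [signOf]

/-- Off the coincidence set, `S² ≤ 4`. -/
theorem ar_pt_sq_le (e₀ e₁ e₂ e₃ : Bool) (h : (!(e₀ ^^ e₁) && (!(e₀ ^^ e₂) && !(e₀ ^^ e₃))) = false) :
    (signOf e₀ + signOf e₁ + signOf e₂ + signOf e₃) ^ 2 ≤ 4 := by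
  revert h
  cases e₀ <;> cases e₁ <;> cases e₂ <;> cases e₃ <;> norm_num [signOf]

/-- If `S² = 4` then exactly three of the four bits agree and `S = 2 (-1)^{maj(e₀,e₁,e₂)}`. -/
theorem ar_pt_maj (e₀ e₁ e₂ e₃ : Bool) (h : (signOf e₀ + signOf e₁ + signOf e₂ + signOf e₃) ^ 2 = 4) :
    signOf e₀ + signOf e₁ + signOf e₂ + signOf e₃ =
      2 * signOf ((e₀ && e₁) ^^ ((e₀ && e₂) ^^ (e₁ && e₂))) := by
  revert h
  cases e₀ <;> cases e₁ <;> cases e₂ <;> cases e₃ <;> norm_num [signOf]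

/-! ### The counting argument -/

/-- **The counting step** (GIVEN stub D as `hD`; the Reed–Muller bound is the landed `stub_rmWeight hD`). Let `f` be
cubic, `e₀ e₁ e₂` cubic with `e₀ ⊕ eᵢ` quadratic (`i = 1,2,3`), `S = Σ_{i<4} (-1)^{eᵢ}` with `Σ_x S(x)² = 4·2ⁿ`, and
`Φ' := 2^{-n} Σ_x (-1)^{f(x)} S(x)/2`. Then `Φ' = 1 ∨ Φ' ≤ 31/32`: summing `ar_pt_ineq` gives
`Σ (-1)^f S ≤ 2·2ⁿ − 4|Z|` for the coincidence set `Z` (degree `≤ 6`), so `Z ≠ ∅ ⇒ |Z| ≥ 2ⁿ/64 ⇒ Φ' ≤ 31/32`; and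
`Z = ∅` forces `S² = 4` everywhere (`ar_pt_sq_le` + the second moment), `S = 2(-1)^{maj}` (`ar_pt_maj`), so `Φ'` is the
bias of the word `f ⊕ maj` of degree `≤ 6`: zero word `⇒ Φ' = 1`, else weight `≥ 2ⁿ/64 ⇒ Φ' ≤ 31/32`. -/
theorem ar_count
    (hD : ∀ (n d : ℕ) (e : (Fin n → Bool) → Bool) (t : Fin n → Bool), IsDegLeFun (d + 1) e →
      IsDegLeFun d (fun x => e x ^^ e (bxor x t)))
    (f e₀ e₁ e₂ e₃ : (Fin n → Bool) → Bool) (S : (Fin n → Bool) → ℝ)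
    (hSx : ∀ x, S x = signOf (e₀ x) + signOf (e₁ x) + signOf (e₂ x) + signOf (e₃ x))
    (hf : IsDegLeFun 3 f) (h₀ : IsDegLeFun 3 e₀) (h₁ : IsDegLeFun 3 e₁) (h₂ : IsDegLeFun 3 e₂)
    (h₀₁ : IsDegLeFun 2 (fun x => e₀ x ^^ e₁ x)) (h₀₂ : IsDegLeFun 2 (fun x => e₀ x ^^ e₂ x))
    (h₀₃ : IsDegLeFun 2 (fun x => e₀ x ^^ e₃ x)) (hS : ∑ x, S x ^ 2 = 4 * (2 : ℝ) ^ n) :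
    ((2 : ℝ) ^ n)⁻¹ * ∑ x, signOf (f x) * (S x / 2) = 1 ∨
      ((2 : ℝ) ^ n)⁻¹ * ∑ x, signOf (f x) * (S x / 2) ≤ 31 / 32 := by
  have hR := stub_rmWeight hD
  have hN : (0 : ℝ) < (2 : ℝ) ^ n := by positivity
  have hcardR : ((univ : Finset (Fin n → Bool)).card : ℝ) = (2 : ℝ) ^ n := by
    rw [card_univ, Fintype.card_fun, Fintype.card_bool, Fintype.card_fin]
    norm_num
  have hhalf : ∑ x, signOf (f x) * (S x / 2) = (∑ x, signOf (f x) * S x) / 2 := by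
    rw [sum_div]
    exact sum_congr rfl fun x _ => by ring
  rw [hhalf]
  -- the coincidence set `Z = {e₀ = e₁ = e₂ = e₃}` has degree ≤ 6
  have hz6 : IsDegLeFun 6 (fun x => !(e₀ x ^^ e₁ x) && (!(e₀ x ^^ e₂ x) && !(e₀ x ^^ e₃ x))) :=
    bb_deg_and (fc_deg_bnot h₀₁) (bb_deg_and (d := 4) (fc_deg_bnot h₀₂) (fc_deg_bnot h₀₃) (by norm_num))
      (by norm_num)
  -- `2 Σ (-1)^f S + 8 |Z| ≤ Σ S² = 4·2ⁿ`
  have hsum : 2 * ∑ x, signOf (f x) * S x +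
      8 * ((univ.filter fun x => (!(e₀ x ^^ e₁ x) && (!(e₀ x ^^ e₂ x) && !(e₀ x ^^ e₃ x))) = true).card : ℝ) ≤
        4 * (2 : ℝ) ^ n := by
    have hZ : ((univ.filter fun x => (!(e₀ x ^^ e₁ x) && (!(e₀ x ^^ e₂ x) && !(e₀ x ^^ e₃ x))) = true).card : ℝ)
        = ∑ x, (if (!(e₀ x ^^ e₁ x) && (!(e₀ x ^^ e₂ x) && !(e₀ x ^^ e₃ x))) = true then (1 : ℝ) else 0) := by
      rw [sum_boole]
    rw [hZ, mul_sum, mul_sum, ← sum_add_distrib, ← hS]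
    refine sum_le_sum fun x _ => ?_
    rw [hSx]
    exact ar_pt_ineq (f x) (e₀ x) (e₁ x) (e₂ x) (e₃ x)
  by_cases hZ : ∃ x, (!(e₀ x ^^ e₁ x) && (!(e₀ x ^^ e₂ x) && !(e₀ x ^^ e₃ x))) = true
  · -- `Z ≠ ∅`: Reed–Muller ⇒ `2ⁿ ≤ 64 |Z|` ⇒ `Φ' ≤ 1 − 2|Z|/2ⁿ ≤ 31/32`
    right
    have hRZ : (2 : ℝ) ^ n ≤ 2 ^ 6 *
        ((univ.filter fun x => (!(e₀ x ^^ e₁ x) && (!(e₀ x ^^ e₂ x) && !(e₀ x ^^ e₃ x))) = true).card : ℝ) := by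
      exact_mod_cast hR n 6 _ hz6 hZ
    rw [show (2 : ℝ) ^ 6 = 64 by norm_num] at hRZ
    rw [inv_mul_le_iff₀ hN]
    linarith
  · -- `Z = ∅`: `S² = 4` everywhere, `S = 2 (-1)^{maj}`, and `Φ'` is the bias of the sextic word `f ⊕ maj`
    have hZf : ∀ x, (!(e₀ x ^^ e₁ x) && (!(e₀ x ^^ e₂ x) && !(e₀ x ^^ e₃ x))) = false := fun x =>
      eq_false_of_ne_true (not_exists.mp hZ x)
    have h4 : ∀ x, S x ^ 2 = 4 := by
      have hle : ∀ x ∈ (univ : Finset (Fin n → Bool)), S x ^ 2 ≤ 4 := fun x _ => by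
        rw [hSx]
        exact ar_pt_sq_le _ _ _ _ (hZf x)
      have heq : ∑ x, S x ^ 2 = ∑ _x : Fin n → Bool, (4 : ℝ) := by
        rw [hS, sum_const, nsmul_eq_mul, hcardR, mul_comm]
      exact fun x => (sum_eq_sum_iff_of_le hle).1 heq x (mem_univ x)
    have hmaj : ∀ x, S x = 2 * signOf ((e₀ x && e₁ x) ^^ ((e₀ x && e₂ x) ^^ (e₁ x && e₂ x))) := fun x => by
      have hx := h4 x
      rw [hSx] at hx ⊢
      exact ar_pt_maj _ _ _ _ hx
    have hc6 : IsDegLeFun 6 (fun x => f x ^^ ((e₀ x && e₁ x) ^^ ((e₀ x && e₂ x) ^^ (e₁ x && e₂ x)))) :=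
      bb_isDegLeFun_bxor (hf.mono (by norm_num))
        (bb_isDegLeFun_bxor (bb_deg_and h₀ h₁ (by norm_num))
          (bb_isDegLeFun_bxor (bb_deg_and h₀ h₂ (by norm_num)) (bb_deg_and h₁ h₂ (by norm_num))))
    have hT : ∑ x, signOf (f x) * S x =
        2 * ∑ x, signOf (f x ^^ ((e₀ x && e₁ x) ^^ ((e₀ x && e₂ x) ^^ (e₁ x && e₂ x)))) := by
      rw [mul_sum]
      exact sum_congr rfl fun x _ => by rw [hmaj x, signOf_xor (f x)]; ring
    rw [hT]
    by_cases hc : ∃ x, (f x ^^ ((e₀ x && e₁ x) ^^ ((e₀ x && e₂ x) ^^ (e₁ x && e₂ x)))) = true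
    · -- nonzero word of degree ≤ 6: weight ≥ 2ⁿ/64
      right
      have hRc : (2 : ℝ) ^ n ≤ 2 ^ 6 * ((univ.filter fun x =>
          (f x ^^ ((e₀ x && e₁ x) ^^ ((e₀ x && e₂ x) ^^ (e₁ x && e₂ x)))) = true).card : ℝ) := by
        exact_mod_cast hR n 6 _ hc6 hc
      rw [show (2 : ℝ) ^ 6 = 64 by norm_num] at hRc
      rw [fc_sum_signOf_eq_card, inv_mul_le_iff₀ hN]
      linarith
    · -- zero word: `Φ' = 1`
      left
      have h1 : ∀ x, signOf (f x ^^ ((e₀ x && e₁ x) ^^ ((e₀ x && e₂ x) ^^ (e₁ x && e₂ x)))) = 1 := fun x => by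
        rw [eq_false_of_ne_true (not_exists.mp hc x)]
        rfl
      have hsum1 : ∑ x, signOf (f x ^^ ((e₀ x && e₁ x) ^^ ((e₀ x && e₂ x) ^^ (e₁ x && e₂ x)))) = (2 : ℝ) ^ n := by
        rw [sum_congr rfl fun x _ => h1 x, sum_const, nsmul_eq_mul, mul_one, hcardR]
      rw [hsum1, show (2 : ℝ) * 2 ^ n / 2 = 2 ^ n by ring, inv_mul_cancel₀ hN.ne']

/-- **Rank-2 perturbation ceiling, from stub D.** For an exact cubic pair `(d, g)` on `m + m` bits in dual form,
three affine `ℓ₁ ℓ₂ ℓ₃` and any cubic `f`: `Φ(f, g ⊕ (ℓ₁ℓ₂ ⊕ ℓ₃)) = 1 ∨ ≤ 31/32`, GIVEN that derivatives lower the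
degree (`hD`). Assembly: sign forms of the `ℓᵢ` (`ar_affine_signForm`), the four-character form of
`(-1)^{ℓ₁ℓ₂ ⊕ ℓ₃}` (`ar_signOf_and`), `W_{g⊕p} = 2^m S/2` (`ar_W_perturb`), `Φ = 2^{-n} Σ (-1)^f S/2`
(`ar_forrelation_of_W`), `Σ S² = 4·2ⁿ` (`ar_second_moment_of_W`), and `ar_count`. -/
theorem ar_rankTwoCeiling_of_derivDegree :
    (∀ (n d : ℕ) (e : (Fin n → Bool) → Bool) (t : Fin n → Bool), IsDegLeFun (d + 1) e →
      IsDegLeFun d (fun x => e x ^^ e (bxor x t))) →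
    ∀ (m : ℕ) (f d g ℓ₁ ℓ₂ ℓ₃ : (Fin (m + m) → Bool) → Bool), IsDegLeFun 3 f → IsDegLeFun 3 d →
      (∀ x, W (fun y => signOf (g y)) x = (2 : ℝ) ^ m * signOf (d x)) →
      IsDegLeFun 1 ℓ₁ → IsDegLeFun 1 ℓ₂ → IsDegLeFun 1 ℓ₃ →
      forrelation f (fun y => g y ^^ ((ℓ₁ y && ℓ₂ y) ^^ ℓ₃ y)) = 1 ∨
        forrelation f (fun y => g y ^^ ((ℓ₁ y && ℓ₂ y) ^^ ℓ₃ y)) ≤ 31 / 32 := by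
  intro hD m f d g ℓ₁ ℓ₂ ℓ₃ hf hd hdual hℓ₁ hℓ₂ hℓ₃
  obtain ⟨c₁, u₁, hs₁⟩ := ar_affine_signForm hD hℓ₁
  obtain ⟨c₂, u₂, hs₂⟩ := ar_affine_signForm hD hℓ₂
  obtain ⟨c₃, u₃, hs₃⟩ := ar_affine_signForm hD hℓ₃
  -- the four-character sign form of the perturbation `p = ℓ₁ℓ₂ ⊕ ℓ₃`
  have hp : ∀ y, signOf ((ℓ₁ y && ℓ₂ y) ^^ ℓ₃ y) =
      (signOf c₃ * twist y u₃ + signOf (c₁ ^^ c₃) * twist y (bxor u₁ u₃) +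
        signOf (c₂ ^^ c₃) * twist y (bxor u₂ u₃) +
        signOf (!(c₁ ^^ (c₂ ^^ c₃))) * twist y (bxor u₁ (bxor u₂ u₃))) / 2 := by
    intro y
    simp only [signOf_xor, signOf_not, ar_signOf_and, hs₁, hs₂, hs₃, twist_bxor_right]
    ring
  have hW := ar_W_perturb g d (fun y => (ℓ₁ y && ℓ₂ y) ^^ ℓ₃ y) c₃ (c₁ ^^ c₃) (c₂ ^^ c₃)
    (!(c₁ ^^ (c₂ ^^ c₃))) u₃ (bxor u₁ u₃) (bxor u₂ u₃) (bxor u₁ (bxor u₂ u₃)) hdual hp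
  rw [ar_forrelation_of_W f (fun y => g y ^^ ((ℓ₁ y && ℓ₂ y) ^^ ℓ₃ y))
    (fun x => (signOf (c₃ ^^ d (bxor x u₃)) + signOf ((c₁ ^^ c₃) ^^ d (bxor x (bxor u₁ u₃))) +
      signOf ((c₂ ^^ c₃) ^^ d (bxor x (bxor u₂ u₃))) +
      signOf ((!(c₁ ^^ (c₂ ^^ c₃))) ^^ d (bxor x (bxor u₁ (bxor u₂ u₃))))) / 2) hW]
  exact ar_count hD f (fun x => c₃ ^^ d (bxor x u₃)) (fun x => (c₁ ^^ c₃) ^^ d (bxor x (bxor u₁ u₃)))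
    (fun x => (c₂ ^^ c₃) ^^ d (bxor x (bxor u₂ u₃)))
    (fun x => (!(c₁ ^^ (c₂ ^^ c₃))) ^^ d (bxor x (bxor u₁ (bxor u₂ u₃))))
    (fun x => signOf (c₃ ^^ d (bxor x u₃)) + signOf ((c₁ ^^ c₃) ^^ d (bxor x (bxor u₁ u₃))) +
      signOf ((c₂ ^^ c₃) ^^ d (bxor x (bxor u₂ u₃))) +
      signOf ((!(c₁ ^^ (c₂ ^^ c₃))) ^^ d (bxor x (bxor u₁ (bxor u₂ u₃)))))
    (fun _ => rfl) hf (ar_deg_e hd _ _) (ar_deg_e hd _ _) (ar_deg_e hd _ _)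
    (ar_deg_pair hD hd _ _ _ _) (ar_deg_pair hD hd _ _ _ _) (ar_deg_pair hD hd _ _ _ _)
    (ar_second_moment_of_W (fun y => signOf (g y ^^ ((ℓ₁ y && ℓ₂ y) ^^ ℓ₃ y))) _ ((2 : ℝ) ^ m)
      (by positivity) (fun y => signOf_sq _) hW (by rw [sq, ← pow_add]))
end Summit.QuantumAdvantage.QuantumAdvantage.Theorems.CubicForrelation.NearExactIsExact
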